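import Literature.NumberTheory.GaloisCohomology.BlochKatoForms
import HarnessLib

/-!
# The Bloch–Kato presentation module maps to Kato's symbolic group
# (Bloch–Kato 1986, Lemma (4.2) ⇒ injectivity half of the symbolic presentation of `H^{n+1}_p(K)`)

Sequel to `GaloisCohomology/BlochKatoForms` (the `K`-module `BlochKatoForms K n` presenting `Ωⁿ_K` and
the comparison map `BlochKatoForms.ofForms : ⋀ⁿ_K Ω[K⁄ℤ] → BlochKatoForms K n`).  Here: the ADDITIVE map

`BlochKatoForms.toSymbolic K p : BlochKatoForms K n →+ KatoCohomologySymbolic p K n`,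
`c • e(v) ↦ [c, v 0, …, v (n-1)}` (zero if some `v i = 0`),

well defined because Kato's symbolic group (`GaloisCohomology/KatoCohomologySymbolic`) satisfies the
relations of `BlochKatoForms`: multiplicativity and vanishing on equal slots are relations (2), (3), and
Bloch–Kato's (4.2.2) follows from relation (4) `[bᵢ, b₁, …, bₙ} = 0` (`symbMap_update_mul_self`).  The
map is only additive — the symbolic group is not a `K`-module (the Artin–Schreier relation (5) is not
`K`-stable) — so it is built through restriction of scalars to `ℤ`.  Composite with `ofForms`:

`BlochKatoForms.exists_addMonoidHom_forms_symbol` : an additive `ψ₀ : Ωⁿ_K → KatoCohomologySymbolic p K n`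
with `ψ₀ (a • dlog b₀ ∧ ⋯ ∧ dlog b_{n-1}) = [a, b}` — the injectivity half of the named fact
`BlochKato1986_symbolicPresentation` (`GaloisCohomology/KatoCohomologyDifferentialForms`), consumed by
crux `WildPurity.PurityTransfer` of summit ResolutionOfSingularities (stub `stub_bkBackwardForms`).
Everything is proved; no named fact is introduced; `p` is arbitrary (no primality or characteristic
hypothesis is needed for this direction).

## References

* S. Bloch, K. Kato, *p-adic étale cohomology*, Publ. Math. IHÉS 63 (1986), 107–152, Lemma (4.2),
  p. 122. [BlochKato1986]
* K. Kato, *Galois cohomology of complete discrete valuation fields*, LNM 967 (1982), §1. [Kato1982]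
-/

noncomputable section

open Function (update)

namespace Literature.NumberTheory.GaloisCohomology

universe u

variable (K : Type u) [Field K] (n : ℕ)

namespace BlochKatoForms

open KatoCohomologySymbolic

variable {n} (p : ℕ)

open scoped Classical in
/-- The symbol attached to a tuple `v : Fin n → K` as an additive map in the coefficient:
`c ↦ [c, v 0, …, v (n-1)}` if all `v i ≠ 0`, and `0` otherwise. [cite: Kato1982, §1] -/
def symbMap (v : Fin n → K) : K →+ KatoCohomologySymbolic p K n :=
  if h : ∀ i, v i ≠ 0 then symbolHom p (fun i => Units.mk0 (v i) (h i)) else 0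

/-- `symbMap` of a tuple with a zero slot is `0`. [folklore] -/
theorem symbMap_eq_zero_of_apply_eq_zero (v : Fin n → K) {i : Fin n} (hi : v i = 0) :
    symbMap K p v = 0 := by
  rw [symbMap, dif_neg]
  push Not
  exact ⟨i, hi⟩

/-- `symbMap` on a tuple of units, presented as `update v i y` with `w` the unit tuple off the slot
`i`: `symbMap (update v i y) c = [c, update w i y}`. [folklore] -/
theorem symbMap_update (v : Fin n → K) (i : Fin n) (w : Fin n → Kˣ)
    (hw : ∀ j, j ≠ i → (w j : K) = v j) (y : Kˣ) (c : K) :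
    symbMap K p (update v i y) c = symbol p c (update w i y) := by
  have hne : ∀ j, update v i (y : K) j ≠ 0 := by
    intro j
    by_cases hj : j = i
    · subst hj; rw [Function.update_self]; exact y.ne_zero
    · rw [Function.update_of_ne hj, ← hw j hj]; exact (w j).ne_zero
  rw [symbMap, dif_pos hne, symbolHom_apply]
  congr 1
  funext j
  ext
  by_cases hj : j = i
  · subst hj; simp
  · simp [Function.update_of_ne hj, hw j hj]

/-- Off the slot `i`, a tuple with non-zero entries is a tuple of units. [folklore] -/
theorem exists_units_of_ne (v : Fin n → K) (i : Fin n) (H : ∀ j, j ≠ i → v j ≠ 0) :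
    ∃ w : Fin n → Kˣ, ∀ j, j ≠ i → (w j : K) = v j :=
  ⟨fun j => if h : j = i then 1 else Units.mk0 (v j) (H j h), fun j hj => by simp [hj]⟩

/-- If some slot `j ≠ i` of `v` vanishes, `symbMap (update v i y) = 0`. [folklore] -/
theorem symbMap_update_eq_zero (v : Fin n → K) (i : Fin n) (H : ¬ ∀ j, j ≠ i → v j ≠ 0) (y : K) :
    symbMap K p (update v i y) = 0 := by
  push Not at H
  obtain ⟨j, hj, hvj⟩ := H
  exact symbMap_eq_zero_of_apply_eq_zero K p _ (i := j) (by rw [Function.update_of_ne hj, hvj])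

/-- Relation (M) under `symbMap`: `symbMap (…, a a', …) c = symbMap (…, a, …) c + symbMap (…, a', …) c`
for `a, a' ≠ 0` (relation (2) of the symbolic group). [cite: BlochKato1986, Lemma (4.2)] -/
theorem symbMap_update_mul (v : Fin n → K) (i : Fin n) {a a' : K} (ha : a ≠ 0) (ha' : a' ≠ 0) (c : K) :
    symbMap K p (update v i (a * a')) c = symbMap K p (update v i a) c + symbMap K p (update v i a') c := by
  by_cases H : ∀ j, j ≠ i → v j ≠ 0
  · obtain ⟨w, hw⟩ := exists_units_of_ne K v i H
    have h1 : symbMap K p (update v i (a * a')) c =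
        symbol p c (update w i (Units.mk0 a ha * Units.mk0 a' ha')) :=
      symbMap_update K p v i w hw (Units.mk0 a ha * Units.mk0 a' ha') c
    have h2 : symbMap K p (update v i a) c = symbol p c (update w i (Units.mk0 a ha)) :=
      symbMap_update K p v i w hw (Units.mk0 a ha) c
    have h3 : symbMap K p (update v i a') c = symbol p c (update w i (Units.mk0 a' ha')) :=
      symbMap_update K p v i w hw (Units.mk0 a' ha') c
    rw [h1, h2, h3, symbol_update_mul]
  · simp only [symbMap_update_eq_zero K p v i H, AddMonoidHom.zero_apply, add_zero]

/-- Relation (A) under `symbMap`: `symbMap v = 0` if two distinct slots agree (relation (3) of the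
symbolic group). [cite: BlochKato1986, Lemma (4.2), (4.2.1)] -/
theorem symbMap_eq_zero_of_apply_eq (v : Fin n → K) {i j : Fin n} (hij : i ≠ j) (h : v i = v j) :
    symbMap K p v = 0 := by
  unfold symbMap
  split_ifs with hv
  · ext c
    rw [symbolHom_apply, AddMonoidHom.zero_apply]
    exact symbol_eq_zero_of_apply_eq p c _ hij (Units.ext h)
  · rfl

/-- The key identity behind (4.2.2): with `c ≠ 0` a unit in the slot `i` available,
`symbMap (…, y, …) (c y) = -[c y, …, c, …}` for every `y` (relation (4) `[u, …, u, …} = 0` applied to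
`u = c y`, and multiplicativity). [cite: BlochKato1986, Lemma (4.2), (4.2.2)] -/
theorem symbMap_update_mul_self (v : Fin n → K) (i : Fin n) (w : Fin n → Kˣ)
    (hw : ∀ j, j ≠ i → (w j : K) = v j) {c : K} (hc : c ≠ 0) (y : K) :
    symbMap K p (update v i y) (c * y) = -symbol p (c * y) (update w i (Units.mk0 c hc)) := by
  by_cases hy : y = 0
  · rw [hy, mul_zero, map_zero, symbol_zero, neg_zero]
  have h0 : symbol p (c * y) (update w i (Units.mk0 c hc * Units.mk0 y hy)) = 0 := by
    have := symbol_apply_self p (update w i (Units.mk0 c hc * Units.mk0 y hy)) i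
    rwa [Function.update_self, Units.val_mul, Units.val_mk0, Units.val_mk0] at this
  rw [symbol_update_mul] at h0
  rw [← Units.val_mk0 hy, symbMap_update K p v i w hw, Units.val_mk0]
  exact eq_neg_of_add_eq_zero_right h0

/-- Relation (Q), (4.2.2), under `symbMap`:
`symbMap (…, a + a', …) (c (a + a')) = symbMap (…, a, …) (c a) + symbMap (…, a', …) (c a')`.
[cite: BlochKato1986, Lemma (4.2), (4.2.2)] -/
theorem symbMap_bk422 (v : Fin n → K) (i : Fin n) (a a' c : K) :
    symbMap K p (update v i (a + a')) (c * (a + a')) =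
      symbMap K p (update v i a) (c * a) + symbMap K p (update v i a') (c * a') := by
  by_cases H : ∀ j, j ≠ i → v j ≠ 0
  · obtain ⟨w, hw⟩ := exists_units_of_ne K v i H
    by_cases hc : c = 0
    · simp only [hc, zero_mul, map_zero, add_zero]
    rw [symbMap_update_mul_self K p v i w hw hc, symbMap_update_mul_self K p v i w hw hc,
      symbMap_update_mul_self K p v i w hw hc, ← neg_add, ← symbol_add, ← mul_add]
  · simp only [symbMap_update_eq_zero K p v i H, AddMonoidHom.zero_apply, add_zero]

/-- The additive map `single v c ↦ symbMap v c` on the free module kills the `K`-span of the relations.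
[cite: BlochKato1986, Lemma (4.2)] -/
theorem liftAddHom_symbMap_eq_zero {x : (Fin n → K) →₀ K} (hx : x ∈ Submodule.span K (rels K n)) :
    Finsupp.liftAddHom (symbMap K p (n := n)) x = 0 := by
  suffices h : ∀ c : K, Finsupp.liftAddHom (symbMap K p (n := n)) (c • x) = 0 by
    simpa only [one_smul] using h 1
  induction hx using Submodule.span_induction with
  | mem x hx =>
    intro c
    rcases hx with ⟨v, i, hv, rfl⟩ | ⟨v, i, a, a', ha, ha', rfl⟩ | ⟨v, i, j, hij, hv, rfl⟩ |
      ⟨v, i, a, a', rfl⟩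
    · rw [Finsupp.smul_single_one, Finsupp.liftAddHom_apply_single,
        symbMap_eq_zero_of_apply_eq_zero K p v hv, AddMonoidHom.zero_apply]
    · rw [smul_sub, smul_sub, Finsupp.smul_single_one, Finsupp.smul_single_one, Finsupp.smul_single_one,
        map_sub, map_sub, Finsupp.liftAddHom_apply_single, Finsupp.liftAddHom_apply_single,
        Finsupp.liftAddHom_apply_single, symbMap_update_mul K p v i ha ha', add_sub_cancel_left, sub_self]
    · rw [Finsupp.smul_single_one, Finsupp.liftAddHom_apply_single,
        symbMap_eq_zero_of_apply_eq K p v hij hv, AddMonoidHom.zero_apply]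
    · rw [smul_sub, smul_sub, smul_smul, smul_smul, smul_smul, Finsupp.smul_single_one,
        Finsupp.smul_single_one, Finsupp.smul_single_one, map_sub, map_sub,
        Finsupp.liftAddHom_apply_single, Finsupp.liftAddHom_apply_single,
        Finsupp.liftAddHom_apply_single, symbMap_bk422 K p v i a a' c, add_sub_cancel_left, sub_self]
  | zero => intro c; rw [smul_zero, map_zero]
  | add x y _ _ hx hy => intro c; rw [smul_add, map_add, hx, hy, add_zero]
  | smul a x _ hx => intro c; rw [smul_smul]; exact hx (c * a)

/-- **The additive comparison map `BlochKatoForms K n → KatoCohomologySymbolic p K n`**,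
`c • e(v) ↦ [c, v 0, …, v (n-1)}` (zero if some `v i = 0`): the symbolic group satisfies the
relations (Z), (M), (A) and — by relation (4) `[bᵢ, b} = 0` — Bloch–Kato's (4.2.2).  It is only
additive (`KatoCohomologySymbolic` is not a `K`-module: the Artin–Schreier relation is not
`K`-stable), so it is built through the restriction of scalars to `ℤ`.
[cite: BlochKato1986, Lemma (4.2), p. 122] -/
def toSymbolic : BlochKatoForms K n →+ KatoCohomologySymbolic p K n :=
  (((Submodule.span K (rels K n)).restrictScalars ℤ).liftQ
      (Finsupp.liftAddHom (symbMap K p (n := n))).toIntLinearMap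
      (fun _ hx => LinearMap.mem_ker.2 (liftAddHom_symbMap_eq_zero K p hx))).toAddMonoidHom.comp
    (Submodule.Quotient.restrictScalarsEquiv ℤ (Submodule.span K (rels K n))).symm.toLinearMap.toAddMonoidHom

/-- `toSymbolic (mk x) = Σ symbMap`-evaluation of `x`. [folklore] -/
theorem toSymbolic_mk (x : (Fin n → K) →₀ K) :
    toSymbolic K p (Submodule.Quotient.mk x) = Finsupp.liftAddHom (symbMap K p (n := n)) x := by
  simp only [toSymbolic, AddMonoidHom.coe_comp, LinearMap.toAddMonoidHom_coe, LinearEquiv.coe_coe,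
    Function.comp_apply, Submodule.Quotient.restrictScalarsEquiv_symm_mk, Submodule.liftQ_apply,
    AddMonoidHom.coe_toIntLinearMap]

/-- `toSymbolic (c • e(v)) = symbMap v c`. [folklore] -/
theorem toSymbolic_smul_gen (v : Fin n → K) (c : K) : toSymbolic K p (c • gen K v) = symbMap K p v c := by
  rw [← mk_single, toSymbolic_mk, Finsupp.liftAddHom_apply_single]

/-- On a tuple of units: `toSymbolic (c • e(b)) = [c, b}`. [cite: BlochKato1986, Lemma (4.2)] -/
theorem toSymbolic_smul_gen_units (b : Fin n → Kˣ) (c : K) :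
    toSymbolic K p (c • gen K fun i => (b i : K)) = symbol p c b := by
  rw [toSymbolic_smul_gen, symbMap, dif_pos (fun i => (b i).ne_zero), symbolHom_apply]
  congr 1
  funext i
  exact Units.mk0_val _ _

/-- **Bloch–Kato, Lemma (4.2), injectivity half, in the form consumed by
`BlochKato1986_symbolicPresentation`**: there is an additive map `ψ₀ : Ωⁿ_K → KatoCohomologySymbolic p K n`
with `ψ₀ (a • dlog b₀ ∧ ⋯ ∧ dlog b_{n-1}) = [a, b}` — namely `toSymbolic ∘ ofForms`.
[cite: BlochKato1986, Lemma (4.2), p. 122] -/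
theorem exists_addMonoidHom_forms_symbol :
    ∃ ψ₀ : (⋀[K]^n (Ω[K⁄ℤ])) →+ KatoCohomologySymbolic p K n,
      ∀ (a : K) (b : Fin n → Kˣ), ψ₀ (a • dlogForm K b) = symbol p a b :=
  ⟨(toSymbolic K p).comp (ofForms K n).toAddMonoidHom, fun a b => by
    rw [AddMonoidHom.coe_comp, Function.comp_apply, LinearMap.toAddMonoidHom_coe, map_smul,
      ofForms_dlogForm, toSymbolic_smul_gen_units]⟩

end BlochKatoForms

end Literature.NumberTheory.GaloisCohomology

end
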